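import Summits.Ventures.GridStability.Lyapunov.StructurePreservingSublevel
import Literature.Analysis.ODE.LyapunovBarbashinKrasovskii
import HarnessLib

/-!
# GridStability/Lyapunov/StructurePreservingRoa — local asymptotic stability of the synchronous
# equilibrium of the Bergen–Hill structure-preserving model (a priori region-of-attraction theorem)

Cell `gridfusion` (LADDER-GRIDFUSION), `plan/PARTITION.md` §0 row `Lyapunov/`, A5″; seat
gridfusion-lyap-1 (g2). THE ASSEMBLY announced by model-2 (INBOX 2026-08-26T21:06:34Z: «what remains
is ODE plumbing only — Lyapunov/ custody») and lit-2 (20:42:17Z, route note): the printed statement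
«the stable equilibrium point of the structure-preserving model with frequency-dependent loads is
(locally) asymptotically stable, with the topological energy function as Lyapunov function»
[cite: BergenHill1981]; [cite: Padiyar2013, §3.2 Remark 2 after eq (3.15)] — obtained here, for the
typed MODEL MV-3, from

* model-2's kernel facts about the model (`Models/StructurePreserving*.lean`: `energy`, `dE/dt`,
  `g(θ)·Q ≤ W ≤ Q`, zero set of `W`, momentum first integral, isolation, state bounds, strict window),
* the phase-space packaging `Lyapunov/StructurePreservingPhase.lean` + `…Sublevel.lean` (this seat:
  first-order field, `V̇ = −Σ Dᵢ δ̇ᵢ²` as a Fréchet-derivative identity, invariance of the constraint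
  set, compactness of the sublevel piece, uniqueness of the equilibrium on the momentum level set),
* the tree's Barbashin–Krasovskii–LaSalle theorem
  `Literature.Analysis.ODE.sublevel_subset_regionOfAttraction_of_noCompleteTrajectory` (lit-6,
  p463197; [cite: RoucheHabetsLaloy1977, Ch. II Thm 1.3 (a)]) with constraint set
  `M = {L = L(δ₀, 0)} ∩ {ω = 0 off gen}` — the device that removes the rotational degeneracy of `V`
  WITHOUT passing to internodal coordinates (lit-2's item (2), model-2's `StructurePreservingInvariant`).

## Statements (MODELLED column; model MV-3 = lossless network, |V| ≡ 1, classical machines,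
frequency-dependent loads `P_D = P⁰_D + D δ̇`; hypotheses = «no critical cutset»-free WINDOW form:
preconnected coupling graph with `bᵢⱼ ≥ β > 0` on its edges, equilibrium branch angles
`|δ₀ᵢ − δ₀ⱼ| ≤ θ < π/2`)
* `eq_equilibrium_of_fderiv_eq_zero` — hypothesis (iii) of Barbashin–Krasovskii for this model: a
  global solution from the window ∩ constraint set along which `V̇ ≡ 0` is the rest point `(δ₀, 0)`;
* `sublevel_subset_regionOfAttraction` — **the theorem**: for every level `c < c⋆(θ, β)` and every
  phase point `y` in `S = {V ≤ c} ∩ window ∩ M`: a global solution from `y` exists, and EVERY global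
  solution from `y` stays in `S` for all `t ≥ 0` and tends to `(δ₀, 0)`;
* `tendsto_of_isSolution` — the same read on model-2's printed solution notion
  `p.shifted.IsSolution δ` (second-order form (3.2) in the frame rotating at `ω₀`): bus angles
  `δ(t) → δ₀`, generator frequency deviations `δ̇ᵢ(t) → 0`;
* `tendsto_of_isSolution_syncFreq` — in the ORIGINAL frame (`p.IsSolution`): `δᵢ(t) − ω₀ t → δ₀ᵢ`
  and every generator frequency `δ̇ᵢ(t) → ω₀ = Σ P⁰ᵢ / Σ Dᵢ` [cite: Padiyar2013, §3.2 eq (3.3)].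
THREE COLUMNS: no certificate is involved (this is the numerics-free «energy route» R-EN of
lit/6-REGISTER §9 for the structure-preserving model); no sentence here says a grid is stable —
«region of attraction» = the stated set of initial states OF MODEL MV-3 is carried to the model's
synchronous equilibrium. Not here: the size of the largest level set inside the window for given
network data (a certificate / BoxCover job), transfer conductances, voltage dynamics (MV-4).
-/

noncomputable section

open Set Filter Topology Real
open Summit.Ventures.GridStability.Models.StructurePreserving
open Summit.Ventures.GridStability.Models.StructurePreserving.Params

namespace Summit.Ventures.GridStability.Lyapunov.StructurePreserving

variable {n : ℕ}

/-! ### Hypothesis (iii): no complete trajectory in `{V̇ = 0}` other than the equilibrium -/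

/-- **A global solution along which `V̇ ≡ 0` is the rest point `(δ₀, 0)`** (well-formed susceptive
data, preconnected coupling graph, `n ≠ 0`, equilibrium window `θ < π/2`; the solution starts in the
window and on the constraint set). Along such a solution every angle velocity vanishes
(`V̇ = −Σ Dᵢ δ̇ᵢ²`), so the generator frequencies vanish identically, hence so do their rates
(uniqueness of the one-sided derivative on `[0, 1]`): every bus is in power balance, i.e. the initial
angle vector is a synchronous equilibrium on the momentum level set of `δ₀` inside the window — which
is `δ₀` (`eq_of_isSyncEquilibrium_of_momentum_eq`). [folklore] -/
theorem eq_equilibrium_of_fderiv_eq_zero {p : Params n} (hp : p.WellFormed) (hn : n ≠ 0)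
    (hconn : p.couplingGraph.Preconnected) (hb : ∀ i j, 0 ≤ p.b i j)
    {δ₀ : Fin n → ℝ} {θ : ℝ} (hθ : θ < π / 2)
    (h0 : ∀ i j, p.b i j ≠ 0 → |δ₀ i - δ₀ j| ≤ θ) (hδ₀ : p.IsSyncEquilibrium δ₀)
    {Y : ℝ → (Fin n → ℝ) × (Fin n → ℝ)} (hY0 : Y 0 ∈ window p ∩ constraintSet p δ₀)
    (hY : ∀ T : ℝ, ∀ t ∈ Icc 0 T, HasDerivWithinAt Y (phaseField p (Y t)) (Icc 0 T) t)
    (hzero : ∀ t, 0 ≤ t → fderiv ℝ (phaseEnergy p δ₀) (Y t) (phaseField p (Y t)) = 0) :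
    Y 0 = (δ₀, 0) := by
  -- all angle velocities vanish along `Y`
  have hF1 : ∀ t, 0 ≤ t → ∀ i, (phaseField p (Y t)).1 i = 0 := fun t ht i =>
    phaseField_fst_eq_zero_of_fderiv_eq_zero hp hδ₀ (hzero t ht) i
  -- so the generator frequencies vanish identically
  have hω : ∀ t, 0 ≤ t → ∀ i ∈ p.gen, (Y t).2 i = 0 := fun t ht i hi => by
    rw [← phaseField_fst_of_mem p (Y t) hi]
    exact hF1 t ht i
  -- hence the generator frequency RATES vanish at `t = 0` (uniqueness of the one-sided derivative
  -- of the identically vanishing coordinate `s ↦ (Y s).2 i` on `[0, 1]`)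
  have hF2 : ∀ i ∈ p.gen, (phaseField p (Y 0)).2 i = 0 := fun i hi => by
    set π₂ : ((Fin n → ℝ) × (Fin n → ℝ)) →L[ℝ] ℝ :=
      (ContinuousLinearMap.proj i).comp (ContinuousLinearMap.snd ℝ (Fin n → ℝ) (Fin n → ℝ))
      with hπ₂
    have hπ : ∀ x : (Fin n → ℝ) × (Fin n → ℝ), π₂ x = x.2 i := fun x => rfl
    have h1 : HasDerivWithinAt (⇑π₂ ∘ Y) (π₂ (phaseField p (Y 0))) (Icc 0 1) 0 :=
      π₂.hasFDerivAt.comp_hasDerivWithinAt (0 : ℝ) (hY 1 0 ⟨le_rfl, zero_le_one⟩)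
    have h2 : HasDerivWithinAt (⇑π₂ ∘ Y) 0 (Icc 0 1) 0 :=
      ((hasDerivAt_const (0 : ℝ) (0 : ℝ)).hasDerivWithinAt (s := Icc 0 1)).congr
        (fun s hs => by
          show π₂ (Y s) = 0
          rw [hπ]
          exact hω s hs.1 i hi)
        (by
          show π₂ (Y 0) = 0
          rw [hπ]
          exact hω 0 le_rfl i hi)
    have h := (uniqueDiffOn_Icc_zero_one 0 ⟨le_rfl, zero_le_one⟩).eq_deriv _ h1 h2
    rwa [hπ] at h
  -- every bus is in power balance at `(Y 0).1`
  have hpe : p.IsSyncEquilibrium (Y 0).1 := fun i => by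
    by_cases hi : i ∈ p.gen
    · have h := hF2 i hi
      rw [phaseField_snd_of_mem p (Y 0) hi, hω 0 le_rfl i hi, mul_zero, sub_zero] at h
      rcases div_eq_zero_iff.1 h with h | h
      · linarith
      · exact absurd h (hp.M_pos i hi).ne'
    · have h := hF1 0 le_rfl i
      rw [phaseField_fst_of_not_mem p (Y 0) hi] at h
      rcases div_eq_zero_iff.1 h with h | h
      · linarith
      · exact absurd h (hp.D_pos i).ne'
  -- all frequency coordinates vanish at `t = 0`
  have hY2 : (Y 0).2 = 0 := funext fun i => by
    by_cases hi : i ∈ p.gen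
    · exact hω 0 le_rfl i hi
    · exact hY0.2.2 i hi
  have hL : p.momentum (Y 0).1 0 = p.momentum δ₀ 0 := by
    have h := hY0.2.1
    rwa [hY2] at h
  have hwin : ∀ i j, p.b i j ≠ 0 → |(Y 0).1 i - (Y 0).1 j| ≤ π / 2 := fun i j hij =>
    (hY0.1 i j hij).le
  have hδ := eq_of_isSyncEquilibrium_of_momentum_eq hp hn hconn hb hθ h0 hwin hδ₀ hpe hL
  exact Prod.ext hδ hY2

/-! ### The region-of-attraction theorem (a priori, all solutions) -/

/-- **Local asymptotic stability of the synchronous equilibrium of the structure-preserving model,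
with a region-of-attraction estimate** (Bergen–Hill's theorem for MODEL MV-3, kernel-checked;
[cite: BergenHill1981]; [cite: Padiyar2013, §3.2 Remark 2]). DATA: well-formed structure-preserving
data `p` on `n ≠ 0` buses (`Mᵢ > 0` on generators, `= 0` on loads, `Dᵢ > 0`, `bᵢⱼ = bⱼᵢ`),
susceptive couplings `bᵢⱼ ≥ 0` with `bᵢⱼ ≥ β > 0` on the edges of a PRECONNECTED coupling graph; a
synchronous equilibrium `δ₀` of the shifted model (`fᵢ(δ₀) = P̄ᵢ`) with branch angles
`|δ₀ᵢ − δ₀ⱼ| ≤ θ < π/2` on coupled pairs; a level `c < c⋆(θ, β) = g(θ)·β·(π/2 − θ)²/4`.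
STATEMENT: for every phase point `y = (δ, ω)` with every coupled branch inside `|δᵢ − δⱼ| < π/2`,
`L(δ, ω) = L(δ₀, 0)`, `ωᵢ = 0` at load buses and `V(δ, ω) ≤ c`: (a) some global solution of the
model `X' = F(X)` (`phaseField`, tree convention) starts at `y`; (b) EVERY global solution from `y`
keeps, for all `t ≥ 0`, every branch inside the window, the constraints, and `V ≤ c`, and tends to
the equilibrium state `(δ₀, 0)`. Proof: `Literature.Analysis.ODE.
sublevel_subset_regionOfAttraction_of_noCompleteTrajectory` with `G = window`, `M = constraintSet`,
`V' = fderiv V` (`V̇ = −Σ Dᵢ δ̇ᵢ² ≤ 0`), compactness `isCompact_sublevel`, `F ∈ C¹`, invariance of `M`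
(`mem_constraintSet_of_solution`) and (iii) `eq_equilibrium_of_fderiv_eq_zero`. No sentence here
says a grid is stable. [folklore] -/
theorem sublevel_subset_regionOfAttraction {p : Params n} (hp : p.WellFormed) (hn : n ≠ 0)
    (hconn : p.couplingGraph.Preconnected) (hb : ∀ i j, 0 ≤ p.b i j) {β : ℝ} (hβ : 0 < β)
    (hβb : ∀ i j, p.couplingGraph.Adj i j → β ≤ p.b i j)
    {δ₀ : Fin n → ℝ} {θ : ℝ} (hθ0 : 0 ≤ θ) (hθ : θ < π / 2)
    (h0 : ∀ i j, p.b i j ≠ 0 → |δ₀ i - δ₀ j| ≤ θ) (hδ₀ : p.IsSyncEquilibrium δ₀)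
    {c : ℝ} (hc : c < levelBound θ β) {y : (Fin n → ℝ) × (Fin n → ℝ)}
    (hy : y ∈ window p ∩ constraintSet p δ₀ ∧ phaseEnergy p δ₀ y ≤ c) :
    (∃ X : ℝ → (Fin n → ℝ) × (Fin n → ℝ), X 0 = y ∧
      ∀ T : ℝ, ∀ t ∈ Icc 0 T, HasDerivWithinAt X (phaseField p (X t)) (Icc 0 T) t) ∧
    ∀ X : ℝ → (Fin n → ℝ) × (Fin n → ℝ), X 0 = y →
      (∀ T : ℝ, ∀ t ∈ Icc 0 T, HasDerivWithinAt X (phaseField p (X t)) (Icc 0 T) t) →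
      (∀ t, 0 ≤ t → X t ∈ window p ∩ constraintSet p δ₀ ∧ phaseEnergy p δ₀ (X t) ≤ c) ∧
        Tendsto X atTop (𝓝 (δ₀, 0)) :=
  Literature.Analysis.ODE.sublevel_subset_regionOfAttraction_of_noCompleteTrajectory
    (F := phaseField p) (V := phaseEnergy p δ₀) (V' := fderiv ℝ (phaseEnergy p δ₀))
    (G := window p) (M := constraintSet p δ₀) (isOpen_window p)
    (fun x _ => (((contDiff_phaseEnergy p δ₀).differentiable one_ne_zero) x).hasFDerivAt)
    (fun x _ => fderiv_phaseEnergy_phaseField_nonpos hp hδ₀ x)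
    (isCompact_sublevel hp hn hconn hb hβ hβb hθ0 hθ h0 hc) (contDiff_phaseField p)
    (fun _ hY0 hY hzero => eq_equilibrium_of_fderiv_eq_zero hp hn hconn hb hθ h0 hδ₀ hY0.1 hY hzero)
    (fun z hz _ X hX0 hX => mem_constraintSet_of_solution hp hn δ₀ hX (by rw [hX0]; exact hz.1.2))
    hy

/-! ### Back to the printed second-order form -/

/-- The energy sees the frequency vector only through the generator nodes. [folklore] -/
theorem energy_congr_gen (p : Params n) (δ₀ δ : Fin n → ℝ) {ω ω' : Fin n → ℝ}
    (h : ∀ i ∈ p.gen, ω i = ω' i) : p.energy δ₀ δ ω = p.energy δ₀ δ ω' := by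
  unfold Params.energy Params.kinetic
  rw [Finset.sum_congr rfl fun i hi => by rw [h i hi]]

/-- The momentum sees the frequency vector only through the generator nodes. [folklore] -/
theorem momentum_congr_gen (p : Params n) (δ : Fin n → ℝ) {ω ω' : Fin n → ℝ}
    (h : ∀ i ∈ p.gen, ω i = ω' i) : p.momentum δ ω = p.momentum δ ω' := by
  unfold Params.momentum
  rw [Finset.sum_congr rfl fun i hi => by rw [h i hi]]

/-- **The printed solutions are solutions of the phase field.** Along every solution `δ` of the
shifted structure-preserving model in model-2's second-order sense (`p.shifted.IsSolution δ`: (3.2)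
with `P̄`, [cite: Padiyar2013, §3.2 eqs (3.2)–(3.5)]) the phase curve
`t ↦ (δ(t), generator frequencies δ̇ᵢ(t), 0 at load buses)` has derivative `phaseField` at every
time. [folklore] -/
theorem hasDerivAt_phase_of_isSolution {p : Params n} (hp : p.WellFormed) {δ : ℝ → Fin n → ℝ}
    (hδ : p.shifted.IsSolution δ) (t : ℝ) :
    HasDerivAt (fun s => ((δ s, fun i => if i ∈ p.gen then deriv (fun u => δ u i) s else 0) :
        (Fin n → ℝ) × (Fin n → ℝ)))
      (phaseField p (δ t, fun i => if i ∈ p.gen then deriv (fun u => δ u i) t else 0)) t := by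
  set x : (Fin n → ℝ) × (Fin n → ℝ) :=
    (δ t, fun i => if i ∈ p.gen then deriv (fun u => δ u i) t else 0) with hx
  have hsw : ∀ i, p.M i * deriv (deriv fun s => δ s i) t + p.D i * deriv (fun s => δ s i) t
      + p.pe (δ t) i = p.Pbar i := fun i => by simpa using hδ.swing t i
  have h1 : HasDerivAt (fun s => δ s) (phaseField p x).1 t := by
    refine hasDerivAt_pi.2 fun i => ?_
    have hd := ((hδ.differentiable i) t).hasDerivAt
    refine hd.congr_deriv ?_
    by_cases hi : i ∈ p.gen
    · rw [phaseField_fst_of_mem p x hi, hx]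
      simp [hi]
    · rw [phaseField_fst_of_not_mem p x hi, hx]
      have h := hsw i
      rw [hp.M_eq_zero i hi, zero_mul, zero_add] at h
      have hD := (hp.D_pos i).ne'
      field_simp
      linarith
  have h2 : HasDerivAt (fun s => fun i => if i ∈ p.gen then deriv (fun u => δ u i) s else (0 : ℝ))
      (phaseField p x).2 t := by
    refine hasDerivAt_pi.2 fun i => ?_
    by_cases hi : i ∈ p.gen
    · simp only [hi, if_true]
      have hd := ((hδ.differentiable_deriv i (by simpa using hi)) t).hasDerivAt
      refine hd.congr_deriv ?_
      rw [phaseField_snd_of_mem p x hi, hx]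
      simp only [hi, if_true]
      have h := hsw i
      have hM := (hp.M_pos i hi).ne'
      field_simp
      linarith
    · simp only [hi, if_false]
      rw [phaseField_snd_of_not_mem p x hi]
      exact hasDerivAt_const t 0
  exact h1.prodMk h2

/-- **Bergen–Hill's theorem in the printed vocabulary (frame rotating at `ω₀`).** Under the data
hypotheses of `sublevel_subset_regionOfAttraction`, every solution `δ` of the shifted
structure-preserving model (model-2's `p.shifted.IsSolution`, all times) whose initial state has
every coupled branch inside `|δᵢ(0) − δⱼ(0)| < π/2`, momentum `L(δ(0), δ̇(0)) = L(δ₀, 0)` and energy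
`V(δ(0), δ̇(0)) ≤ c < c⋆(θ, β)`, keeps `V ≤ c` and the window for all `t ≥ 0`, and converges:
`δ(t) → δ₀` (every bus angle) and `δ̇ᵢ(t) → 0` (every generator frequency deviation).
MODEL MV-3; no sentence here says a grid is stable. [folklore] -/
theorem tendsto_of_isSolution {p : Params n} (hp : p.WellFormed) (hn : n ≠ 0)
    (hconn : p.couplingGraph.Preconnected) (hb : ∀ i j, 0 ≤ p.b i j) {β : ℝ} (hβ : 0 < β)
    (hβb : ∀ i j, p.couplingGraph.Adj i j → β ≤ p.b i j)
    {δ₀ : Fin n → ℝ} {θ : ℝ} (hθ0 : 0 ≤ θ) (hθ : θ < π / 2)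
    (h0 : ∀ i j, p.b i j ≠ 0 → |δ₀ i - δ₀ j| ≤ θ) (hδ₀ : p.IsSyncEquilibrium δ₀)
    {c : ℝ} (hc : c < levelBound θ β) {δ : ℝ → Fin n → ℝ} (hδ : p.shifted.IsSolution δ)
    (hwin : ∀ i j, p.b i j ≠ 0 → |δ 0 i - δ 0 j| < π / 2)
    (hL : p.momentum (δ 0) (fun i => deriv (fun u => δ u i) 0) = p.momentum δ₀ 0)
    (hV : p.energy δ₀ (δ 0) (fun i => deriv (fun u => δ u i) 0) ≤ c) :
    (∀ t, 0 ≤ t → (∀ i j, p.b i j ≠ 0 → |δ t i - δ t j| < π / 2) ∧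
        p.energy δ₀ (δ t) (fun i => deriv (fun u => δ u i) t) ≤ c) ∧
      Tendsto δ atTop (𝓝 δ₀) ∧
      ∀ i ∈ p.gen, Tendsto (fun t => deriv (fun u => δ u i) t) atTop (𝓝 0) := by
  set X : ℝ → (Fin n → ℝ) × (Fin n → ℝ) :=
    fun s => (δ s, fun i => if i ∈ p.gen then deriv (fun u => δ u i) s else 0) with hX
  have hgen : ∀ s, ∀ i ∈ p.gen, (X s).2 i = deriv (fun u => δ u i) s := fun s i hi => by
    simp [hX, hi]
  have hXsol : ∀ T : ℝ, ∀ t ∈ Icc 0 T, HasDerivWithinAt X (phaseField p (X t)) (Icc 0 T) t :=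
    fun T t _ => (hasDerivAt_phase_of_isSolution hp hδ t).hasDerivWithinAt
  have hy : X 0 ∈ window p ∩ constraintSet p δ₀ ∧ phaseEnergy p δ₀ (X 0) ≤ c := by
    refine ⟨⟨hwin, ?_, fun i hi => by simp [hX, hi]⟩, ?_⟩
    · rw [momentum_congr_gen p (δ 0) (hgen 0)]
      exact hL
    · rw [phaseEnergy_apply, energy_congr_gen p δ₀ (δ 0) (hgen 0)]
      exact hV
  obtain ⟨-, hall⟩ := sublevel_subset_regionOfAttraction hp hn hconn hb hβ hβb hθ0 hθ h0 hδ₀ hc hy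
  obtain ⟨hstay, hlim⟩ := hall X rfl hXsol
  refine ⟨fun t ht => ⟨(hstay t ht).1.1, ?_⟩, ?_, fun i hi => ?_⟩
  · rw [← energy_congr_gen p δ₀ (δ t) (hgen t)]
    exact (hstay t ht).2
  · have h := (continuous_fst.tendsto _).comp hlim
    simpa [hX, Function.comp_def] using h
  · have h := (((continuous_apply i).comp continuous_snd).tendsto _).comp hlim
    simpa [hX, hi, Function.comp_def] using h

/-- **Bergen–Hill's theorem in the original frame: synchronisation at the frequency `ω₀`.** Under
the data hypotheses of `sublevel_subset_regionOfAttraction`, every solution `δ` of the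
structure-preserving model AS PRINTED (model-2's `p.IsSolution`, powers `P⁰`) whose initial state
has every coupled branch inside the window, `L(δ(0), δ̇(0) − ω₀) = L(δ₀, 0)` and
`V(δ(0), δ̇(0) − ω₀) ≤ c < c⋆(θ, β)`, satisfies `δᵢ(t) − ω₀ t → δ₀ᵢ` at every bus and
`δ̇ᵢ(t) → ω₀ = Σ P⁰ᵢ / Σ Dᵢ` at every generator [cite: Padiyar2013, §3.2 eqs (3.3)–(3.5), Remark 2]
(via model-2's rotating-frame lemma `IsSolution.shift`). MODEL MV-3; no sentence here says a grid
is stable. [folklore] -/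
theorem tendsto_of_isSolution_syncFreq {p : Params n} (hp : p.WellFormed) (hn : n ≠ 0)
    (hconn : p.couplingGraph.Preconnected) (hb : ∀ i j, 0 ≤ p.b i j) {β : ℝ} (hβ : 0 < β)
    (hβb : ∀ i j, p.couplingGraph.Adj i j → β ≤ p.b i j)
    {δ₀ : Fin n → ℝ} {θ : ℝ} (hθ0 : 0 ≤ θ) (hθ : θ < π / 2)
    (h0 : ∀ i j, p.b i j ≠ 0 → |δ₀ i - δ₀ j| ≤ θ) (hδ₀ : p.IsSyncEquilibrium δ₀)
    {c : ℝ} (hc : c < levelBound θ β) {δ : ℝ → Fin n → ℝ} (hδ : p.IsSolution δ)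
    (hwin : ∀ i j, p.b i j ≠ 0 → |δ 0 i - δ 0 j| < π / 2)
    (hL : p.momentum (δ 0) (fun i => deriv (fun u => δ u i) 0 - p.syncFreq) = p.momentum δ₀ 0)
    (hV : p.energy δ₀ (δ 0) (fun i => deriv (fun u => δ u i) 0 - p.syncFreq) ≤ c) :
    Tendsto (fun t => fun i => δ t i - p.syncFreq * t) atTop (𝓝 δ₀) ∧
      ∀ i ∈ p.gen, Tendsto (fun t => deriv (fun u => δ u i) t) atTop (𝓝 p.syncFreq) := by
  have hs := hδ.shift
  have hderiv : ∀ i t, deriv (fun s => δ s i - p.syncFreq * s) t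
      = deriv (fun s => δ s i) t - p.syncFreq := by
    intro i t
    have h1 := ((hδ.differentiable i) t).hasDerivAt
    have h2 : HasDerivAt (fun s : ℝ => p.syncFreq * s) p.syncFreq t := by
      simpa using (hasDerivAt_id t).const_mul p.syncFreq
    exact (h1.sub h2).deriv
  have hwin' : ∀ i j, p.b i j ≠ 0 →
      |(δ 0 i - p.syncFreq * 0) - (δ 0 j - p.syncFreq * 0)| < π / 2 := by
    simpa using hwin
  have hL' : p.momentum (fun i => δ 0 i - p.syncFreq * 0)
      (fun i => deriv (fun u => δ u i - p.syncFreq * u) 0) = p.momentum δ₀ 0 := by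
    simpa [hderiv] using hL
  have hV' : p.energy δ₀ (fun i => δ 0 i - p.syncFreq * 0)
      (fun i => deriv (fun u => δ u i - p.syncFreq * u) 0) ≤ c := by
    simpa [hderiv] using hV
  obtain ⟨-, hlim, hfreq⟩ := tendsto_of_isSolution hp hn hconn hb hβ hβb hθ0 hθ h0 hδ₀ hc hs
    hwin' hL' hV'
  refine ⟨hlim, fun i hi => ?_⟩
  have h := (hfreq i hi).add_const p.syncFreq
  simpa [hderiv] using h

end Summit.Ventures.GridStability.Lyapunov.StructurePreserving

end
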